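import Mathlib.Data.Finset.SymmDiff
import Mathlib.Data.Finset.Powerset
import Mathlib.Data.Fintype.Pi
import Mathlib.Data.ZMod.Basic
import Mathlib.Algebra.BigOperators.Ring.Finset
import Literature.Computability.MetaComplexity.ResLinExtensible
import Literature.Computability.MetaComplexity.ResLinTreeLikeCompleteness
import Literature.Computability.MetaComplexity.ResolutionPigeonholeProofs
import HarnessLib

/-!
# The weak pigeonhole principle in tree-like Res(⊕): size `≥ 2^n` and clause space `≥ n` (GOR 2024, Thm 3)

`PHPᵐₙ` (`pigeonholeCNF m n`: `m` pigeons, `n` holes, variable `i·n + j` = "pigeon `i` sits in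
hole `j`", pigeon clauses `⋁_{j<n} x_{ij}`, hole clauses `¬x_{ij} ∨ ¬x_{i'j}`) with ANY number
`m` of pigeons. Following Itsykson–Sokolov [MFCS 2014, Lemma 3: systems with `≤ (n-1)/2`
equations] and Gryaznov–Ovcharov–Riazanov [ACM ToCT 2024, Lemma 2, credited to M. Garlík: `n - 1`],
call an assignment PROPER (acceptable) if it satisfies all hole clauses (`holeClauses m n`).

* **Lemma 2** (`isExtensible_pigeonholeCNF`): `PHPᵐₙ` is `n`-extensible w.r.t. its hole clauses
  (`ResLinExtensible.lean`): every linear system over `𝔽₂` with fewer than `n` equations that has a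
  proper solution has, for every pigeon `i < m`, a proper solution placing pigeon `i` in a hole.
  Proof as printed: a proper solution with the minimum number of ones has at most `k` ones (else
  the `> k` columns of its support are dependent: remove an even-parity subset — properness is
  downward closed); so fewer than `n` holes are occupied; the columns of the support together with
  pigeon `i`'s variables at the EMPTY holes number `≥ n > k`, hence carry a nonempty even-parity
  set `U`; flipping `U` keeps the system and properness, and by minimality `U` meets an empty hole
  of pigeon `i`. "Dependent columns" is done by pigeonhole on parity vectors
  (`exists_nonempty_even_subset`: `> k` columns, `2^k` parity patterns), no matrix rank needed.
* **Theorem 3** (`two_pow_le_length_pigeonholeCNF_treeLike`, `le_resLinClauseSpace_pigeonholeCNF`):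
  every TREE-LIKE Res(⊕) refutation (semantic weakening) of `PHPᵐₙ` has at least `2^n` lines, and
  every configuration-style Res(⊕) refutation has clause space `≥ n`; `ℕ∞` form
  `le_minResLinClauseSpace_pigeonholeCNF`.

Constants vs print: GOR state `(n-1)`-extensible, `2^{n-1}` and `n - 1`; their proof treats
systems with `k ≤ n - 1` equations, i.e. gives `n`-extensibility in their own convention
("fewer than `m` equations"), whence `2^n` and `n` here (kernel-checked). Itsykson–Sokolov 2014
had `2^{(n-1)/2}`. Upper bound in print: tree-like Res(⊕) refutes `PHPⁿ⁺¹ₙ` in size `2^{O(n)}`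
(Oparin 2016, quoted in Byramji–Impagliazzo 2025 §7), so the tree-like bound is tight up to the
constant in the exponent. The rank / width rail gives nothing here: the pigeon clauses have width
`n`.

## References

* S. Gryaznov, S. Ovcharov, A. Riazanov, ACM Trans. Comput. Theory 16(3) (2024) = arXiv:2404.08370,
  §3.1.1 (Lemma 2, Theorem 3) [GryaznovOvcharovRiazanov2024].
* D. Itsykson, D. Sokolov, *Lower bounds for splittings by linear combinations*, MFCS 2014, §4
  (Lemma 3, Theorem 4); Ann. Pure Appl. Logic 171 (2020) [ItsyksonSokolov2020].
* A. Haken, *The intractability of resolution*, TCS 39 (1985) (`PHP`) [Haken1985].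
-/

namespace Literature.Computability.MetaComplexity

open _root_.Computability Complexity Finset

/-! ### The clauses of `PHPᵐₙ` -/

/-- The set `HOLESᵐₙ` of hole clauses `¬x_{ij} ∨ ¬x_{i'j}` (`j < n`, `i < i' < m`) of `PHPᵐₙ`.
[Gryaznov–Ovcharov–Riazanov 2024, §3.1.1 (`HOLESᵐₙ`)] [cite: GryaznovOvcharovRiazanov2024, §3.1.1] -/
def holeClauses (m n : ℕ) : Set (Clause ℕ) :=
  {c | ∃ j i i' : ℕ, j < n ∧ i < i' ∧ i' < m ∧ c = [(i * n + j, false), (i' * n + j, false)]}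

/-- The clauses of `pigeonholeCNF m n`: the pigeon clauses `⋁_{j<n} x_{ij}` (`i < m`) and the hole
clauses. [Haken 1985, §1] [cite: Haken1985, §1] -/
theorem mem_pigeonholeCNF_iff {m n : ℕ} {c : Clause ℕ} :
    c ∈ pigeonholeCNF m n ↔
      (∃ i < m, c = (List.range n).map fun j => (i * n + j, true)) ∨ c ∈ holeClauses m n := by
  unfold pigeonholeCNF holeClauses
  simp only [List.mem_append, List.mem_map, List.mem_range, List.mem_flatMap, Set.mem_setOf_eq]
  constructor
  · rintro (⟨i, hi, rfl⟩ | ⟨j, hj, i', hi', i, hi, rfl⟩)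
    · exact Or.inl ⟨i, hi, rfl⟩
    · exact Or.inr ⟨j, i, i', hj, hi, hi', rfl⟩
  · rintro (⟨i, hi, rfl⟩ | ⟨j, i, i', hj, hi, hi', rfl⟩)
    · exact Or.inl ⟨i, hi, rfl⟩
    · exact Or.inr ⟨j, hj, i', hi', i, hi, rfl⟩

/-- Hole clauses are clauses of `PHPᵐₙ`. [Haken 1985, §1] [cite: Haken1985, §1] -/
theorem mem_pigeonholeCNF_of_mem_holeClauses {m n : ℕ} {c : Clause ℕ} (hc : c ∈ holeClauses m n) :
    c ∈ pigeonholeCNF m n :=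
  mem_pigeonholeCNF_iff.2 (Or.inr hc)

/-- PROPER (acceptable) assignments: no hole holds two of the pigeons `< m`.
[Gryaznov–Ovcharov–Riazanov 2024, §3.1.1 ("`HOLESᵐₙ`-proper solutions encode partial injective
mappings"); Itsykson–Sokolov 2014, §4 ("acceptable")] [cite: GryaznovOvcharovRiazanov2024, §3.1.1] -/
theorem isFProper_holeClauses_iff {m n : ℕ} {σ : ℕ → Bool} :
    IsFProper (holeClauses m n) σ ↔
      ∀ j i i' : ℕ, j < n → i < i' → i' < m → ¬ (σ (i * n + j) = true ∧ σ (i' * n + j) = true) := by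
  unfold IsFProper holeClauses
  simp only [Set.mem_setOf_eq]
  constructor
  · intro h j i i' hj hii' hi' ⟨h1, h2⟩
    have := h _ ⟨j, i, i', hj, hii', hi', rfl⟩
    simp [Clause.eval, Literal.eval, h1, h2] at this
  · rintro h c ⟨j, i, i', hj, hii', hi', rfl⟩
    have := h j i i' hj hii' hi'
    revert this
    cases h1 : σ (i * n + j) <;> cases h2 : σ (i' * n + j) <;> simp [Clause.eval, Literal.eval, h1, h2]

/-- Properness is downward closed: switching ones to zeros keeps an assignment proper.
[Gryaznov–Ovcharov–Riazanov 2024, Lemma 2 (proof, "if we change any 1 to 0 …")]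
[cite: GryaznovOvcharovRiazanov2024, Lemma 2] -/
theorem IsFProper.holeClauses_anti {m n : ℕ} {σ τ : ℕ → Bool} (h : IsFProper (holeClauses m n) σ)
    (hle : ∀ v, τ v = true → σ v = true) : IsFProper (holeClauses m n) τ := by
  rw [isFProper_holeClauses_iff] at h ⊢
  intro j i i' hj hii' hi' ⟨h1, h2⟩
  exact h j i i' hj hii' hi' ⟨hle _ h1, hle _ h2⟩

/-- The all-false assignment is proper. [Gryaznov–Ovcharov–Riazanov 2024, §3.1.1] [cite: GryaznovOvcharovRiazanov2024, §3.1.1] -/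
theorem isFProper_holeClauses_false (m n : ℕ) : IsFProper (holeClauses m n) fun _ => false := by
  rw [isFProper_holeClauses_iff]
  simp

/-! ### Assignments given by finite sets; parities -/

/-- The assignment with set of ones `T`. [folklore] -/
def assignOf (T : Finset ℕ) : ℕ → Bool := fun v => decide (v ∈ T)

/-- The parity `⊕_{v ∈ f} [v ∈ T]` in `𝔽₂` of the form `f` under the assignment with ones `T`. [folklore] -/
def parityIn (T f : Finset ℕ) : ZMod 2 := ∑ v ∈ f, if v ∈ T then 1 else 0

/-- Unfolding `assignOf`. [folklore] -/
@[simp] theorem assignOf_apply (T : Finset ℕ) (v : ℕ) : assignOf T v = decide (v ∈ T) := rfl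

/-- The equation `(f = b)` holds under the assignment with ones `T` iff the parity of `f` on `T`
is `b`. [Itsykson–Sokolov 2020, §2] [cite: ItsyksonSokolov2020, §2] -/
theorem linLit_eval_assignOf_iff (T f : Finset ℕ) (b : Bool) :
    LinLit.eval (assignOf T) (f, b) = true ↔ parityIn T f = if b = true then 1 else 0 := by
  rw [linLit_eval_eq_true_iff_sum, parityIn]
  have : ∀ v, (if assignOf T v = true then (1 : ZMod 2) else 0) = if v ∈ T then 1 else 0 := by
    intro v; simp [assignOf]
  simp_rw [this]

/-- In `𝔽₂`, `p + p = 0`. [folklore] -/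
private theorem zmod2_add_self (p : ZMod 2) : p + p = 0 := by
  fin_cases p <;> decide

/-- Parities add under symmetric difference: `[f](T ∆ U) = [f](T) + [f](U)`. [folklore] -/
theorem parityIn_symmDiff (T U f : Finset ℕ) :
    parityIn (symmDiff T U) f = parityIn T f + parityIn U f := by
  unfold parityIn
  rw [← Finset.sum_add_distrib]
  refine Finset.sum_congr rfl fun v _ => ?_
  by_cases hT : v ∈ T <;> by_cases hU : v ∈ U <;> simp [Finset.mem_symmDiff, hT, hU, zmod2_add_self]

/-- An assignment solving a system keeps solving it after flipping a set of even parity on every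
form of the system. [Gryaznov–Ovcharov–Riazanov 2024, Lemma 2 (proof: "`σ + τ` is a solution")]
[cite: GryaznovOvcharovRiazanov2024, Lemma 2] -/
theorem solves_symmDiff_of_even {T U : Finset ℕ} {Φ : List LinLit}
    (hT : ∀ e ∈ Φ, LinLit.eval (assignOf T) e = true) (hU : ∀ e ∈ Φ, parityIn U e.1 = 0) :
    ∀ e ∈ Φ, LinLit.eval (assignOf (symmDiff T U)) e = true := by
  rintro ⟨f, b⟩ he
  rw [linLit_eval_assignOf_iff, parityIn_symmDiff, hU _ he, add_zero]
  exact (linLit_eval_assignOf_iff T f b).1 (hT _ he)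

/-- **Dependent columns, by pigeonhole**: more than `k` columns carry a nonempty subset of even
parity on each of `k` given forms (`2^k` parity patterns, `2^{|I|} > 2^k` subsets of `I`; two
subsets with the same pattern have a symmetric difference of even parities).
[Gryaznov–Ovcharov–Riazanov 2024, Lemma 2 (proof: "this system has a non-trivial solution")] [folklore] -/
theorem exists_nonempty_even_subset (I : Finset ℕ) (Φ : List LinLit) (h : Φ.length < I.card) :
    ∃ U ⊆ I, U.Nonempty ∧ ∀ e ∈ Φ, parityIn U e.1 = 0 := by
  classical
  let g : Finset ℕ → (Fin Φ.length → ZMod 2) := fun U t => parityIn U (Φ.get t).1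
  have hmaps : ∀ U ∈ I.powerset, g U ∈ (Finset.univ : Finset (Fin Φ.length → ZMod 2)) :=
    fun _ _ => Finset.mem_univ _
  have hcard : (Finset.univ : Finset (Fin Φ.length → ZMod 2)).card < I.powerset.card := by
    rw [Finset.card_univ, Fintype.card_fun, ZMod.card, Fintype.card_fin, Finset.card_powerset]
    exact Nat.pow_lt_pow_right (by norm_num) h
  obtain ⟨U₁, hU₁, U₂, hU₂, hne, hg⟩ := Finset.exists_ne_map_eq_of_card_lt_of_maps_to hcard hmaps
  rw [Finset.mem_powerset] at hU₁ hU₂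
  refine ⟨symmDiff U₁ U₂, ?_, ?_, ?_⟩
  · intro v hv
    rw [Finset.mem_symmDiff] at hv
    rcases hv with ⟨h1, -⟩ | ⟨h2, -⟩
    · exact hU₁ h1
    · exact hU₂ h2
  · rw [Finset.nonempty_iff_ne_empty]
    intro h0
    exact hne (symmDiff_eq_bot.1 h0)
  · intro e he
    obtain ⟨t, ht, rfl⟩ := List.getElem_of_mem he
    have hgt := congrFun hg ⟨t, ht⟩
    simp only [g, List.get_eq_getElem] at hgt
    rw [parityIn_symmDiff, hgt, zmod2_add_self]

/-! ### Lemma 2: `PHPᵐₙ` is `n`-extensible w.r.t. its hole clauses -/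

/-- Residue of a pigeon variable: `(i·n + j) % n = j` for `j < n`. [folklore] -/
private theorem pigeonVar_mod {n i j : ℕ} (hj : j < n) : (i * n + j) % n = j := by
  rw [Nat.add_comm, Nat.add_mul_mod_self_right, Nat.mod_eq_of_lt hj]

/-- Quotient of a pigeon variable: `(i·n + j) / n = i` for `j < n`. [folklore] -/
private theorem pigeonVar_div {n i j : ℕ} (hj : j < n) : (i * n + j) / n = i := by
  have hn : 0 < n := by omega
  rw [Nat.add_comm, Nat.add_mul_div_right _ _ hn, Nat.div_eq_of_lt hj, zero_add]

/-- **Lemma 2** [Gryaznov–Ovcharov–Riazanov 2024, Lemma 2 (M. Garlík); Itsykson–Sokolov 2014,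
Lemma 3 with `(n-1)/2`]: `PHPᵐₙ` is `n`-extensible with respect to its hole clauses — every linear
system with fewer than `n` equations that has a proper solution has, for every pigeon clause, a
proper solution satisfying it. [cite: GryaznovOvcharovRiazanov2024, Lemma 2] -/
theorem isExtensible_pigeonholeCNF (m n : ℕ) :
    IsExtensible (pigeonholeCNF m n) (holeClauses m n) n := by
  classical
  intro Φ hlen hsol c hc hcF
  obtain ⟨σ₀, hσ₀F, hσ₀Φ⟩ := hsol
  -- `c` is the pigeon clause of some pigeon `i < m`
  obtain ⟨i, him, rfl⟩ : ∃ i < m, c = (List.range n).map fun j => (i * n + j, true) := by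
    rcases mem_pigeonholeCNF_iff.1 hc with h | h
    · exact h
    · exact absurd h hcF
  -- ### the window `V` of all variables of `Φ`, and the good sets of ones inside it
  set V : Finset ℕ := Φ.toFinset.biUnion Prod.fst with hV
  have hfV : ∀ e ∈ Φ, e.1 ⊆ V := fun e he =>
    Finset.subset_biUnion_of_mem Prod.fst (List.mem_toFinset.2 he)
  let Good : Finset ℕ → Prop := fun T =>
    IsFProper (holeClauses m n) (assignOf T) ∧ ∀ e ∈ Φ, LinLit.eval (assignOf T) e = true
  set 𝒢 : Finset (Finset ℕ) := V.powerset.filter Good with h𝒢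
  have hmem𝒢 : ∀ T, T ∈ 𝒢 ↔ T ⊆ V ∧ Good T := fun T => by
    rw [h𝒢, Finset.mem_filter, Finset.mem_powerset]
  -- the proper solution `σ₀`, cut down to `V`, is good
  have hT₀ : V.filter (fun v => σ₀ v = true) ∈ 𝒢 := by
    rw [hmem𝒢]
    refine ⟨Finset.filter_subset _ _, ?_, ?_⟩
    · exact hσ₀F.holeClauses_anti fun v hv => by
        simp only [assignOf_apply, decide_eq_true_eq, Finset.mem_filter] at hv; exact hv.2
    · rintro ⟨f, b⟩ he
      have hsub := hfV _ he
      have h0 := hσ₀Φ _ he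
      -- the value of `(f = b)` only depends on the variables of `f ⊆ V`, where the two agree
      have hfilter : f.filter (fun v => assignOf (V.filter fun v => σ₀ v = true) v = true) =
          f.filter (fun v => σ₀ v = true) := by
        refine Finset.filter_congr fun v hv => ?_
        simp [assignOf, hsub hv]
      unfold LinLit.eval at h0 ⊢
      simp only at h0 ⊢
      rw [hfilter]
      exact h0
  -- a good set with the minimum number of ones
  obtain ⟨T, hT𝒢, hTmin⟩ := Finset.exists_min_image 𝒢 Finset.card ⟨_, hT₀⟩
  obtain ⟨hTV, hTprop, hTsol⟩ := (hmem𝒢 T).1 hT𝒢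
  -- removing a nonempty even-parity subset of `T` would give a smaller good set
  have hnoeven : ∀ U ⊆ T, U.Nonempty → (∀ e ∈ Φ, parityIn U e.1 = 0) → False := by
    intro U hUT hUne hUeven
    have hsd : symmDiff T U = T \ U := by
      ext v
      rw [Finset.mem_symmDiff, Finset.mem_sdiff]
      constructor
      · rintro (⟨h1, h2⟩ | ⟨h1, h2⟩)
        · exact ⟨h1, h2⟩
        · exact absurd (hUT h1) h2
      · rintro ⟨h1, h2⟩; exact Or.inl ⟨h1, h2⟩
    have hgood : T \ U ∈ 𝒢 := by
      rw [hmem𝒢]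
      refine ⟨(Finset.sdiff_subset).trans hTV, ?_, ?_⟩
      · exact hTprop.holeClauses_anti fun v hv => by
          simp only [assignOf_apply, decide_eq_true_eq, Finset.mem_sdiff] at hv ⊢; exact hv.1
      · rw [← hsd]; exact solves_symmDiff_of_even hTsol hUeven
    have hlt : (T \ U).card < T.card := by
      rw [Finset.card_sdiff_of_subset hUT]
      have := Finset.card_pos.2 hUne
      have := Finset.card_le_card hUT
      omega
    exact absurd (hTmin _ hgood) (not_le.2 hlt)
  -- ### Step 1: `T` has at most `k` ones
  have hTcard : T.card ≤ Φ.length := by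
    by_contra hlt
    push Not at hlt
    obtain ⟨U, hUT, hUne, hUeven⟩ := exists_nonempty_even_subset T Φ hlt
    exact hnoeven U hUT hUne hUeven
  -- ### Step 2: place pigeon `i`
  by_cases hplaced : ∃ j < n, i * n + j ∈ T
  · -- pigeon `i` already sits in a hole
    obtain ⟨j, hj, hij⟩ := hplaced
    refine ⟨assignOf T, hTprop, hTsol, ?_⟩
    simp only [Clause.eval, List.any_eq_true, List.mem_map, List.mem_range]
    exact ⟨(i * n + j, true), ⟨j, hj, rfl⟩, by simp [Literal.eval, hij]⟩
  · push Not at hplaced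
    -- occupied holes `H`, empty holes `E`, pigeon `i`'s variables `J` at the empty holes
    set H : Finset ℕ := T.image (fun v => v % n) with hH
    set E : Finset ℕ := Finset.range n \ H with hE
    set J : Finset ℕ := E.image (fun j => i * n + j) with hJ
    have hHcard : H.card ≤ T.card := Finset.card_image_le
    have hEcard : n - T.card ≤ E.card := by
      have h1 : (Finset.range n).card - H.card ≤ E.card := Finset.le_card_sdiff _ _
      rw [Finset.card_range] at h1
      omega
    have hJinj : Set.InjOn (fun j => i * n + j) (E : Set ℕ) := fun j₁ _ j₂ _ h => by
      simpa using h
    have hJcard : J.card = E.card := Finset.card_image_of_injOn hJinj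
    have hmemJ : ∀ v, v ∈ J ↔ ∃ j, j < n ∧ j ∉ H ∧ v = i * n + j := by
      intro v
      rw [hJ, Finset.mem_image]
      constructor
      · rintro ⟨j, hj, rfl⟩
        rw [hE, Finset.mem_sdiff, Finset.mem_range] at hj
        exact ⟨j, hj.1, hj.2, rfl⟩
      · rintro ⟨j, hj, hjH, rfl⟩
        exact ⟨j, by rw [hE, Finset.mem_sdiff, Finset.mem_range]; exact ⟨hj, hjH⟩, rfl⟩
    -- an empty hole holds no pigeon of `T`
    have hempty : ∀ j, j < n → j ∉ H → ∀ i', i' * n + j ∉ T := by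
      intro j hj hjH i' hmem
      apply hjH
      rw [hH, Finset.mem_image]
      exact ⟨i' * n + j, hmem, pigeonVar_mod hj⟩
    have hJT : Disjoint J T := by
      rw [Finset.disjoint_left]
      intro v hvJ hvT
      obtain ⟨j, hj, -, rfl⟩ := (hmemJ v).1 hvJ
      exact hplaced j hj hvT
    -- the columns `T ∪ J` are more than `k`: a nonempty even-parity set `U ⊆ T ∪ J`
    have hIcard : Φ.length < (T ∪ J).card := by
      rw [Finset.card_union_of_disjoint hJT.symm, hJcard]
      omega
    obtain ⟨U, hUI, hUne, hUeven⟩ := exists_nonempty_even_subset (T ∪ J) Φ hIcard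
    -- `U` meets `J` (else `T ∖ U` would be a smaller good set)
    obtain ⟨v₀, hv₀U, hv₀J⟩ : ∃ v ∈ U, v ∈ J := by
      by_contra hno
      push Not at hno
      have hUT : U ⊆ T := fun v hv => by
        rcases Finset.mem_union.1 (hUI hv) with h | h
        · exact h
        · exact absurd h (hno v hv)
      exact hnoeven U hUT hUne hUeven
    -- the flipped assignment `T ∆ U`
    refine ⟨assignOf (symmDiff T U), ?_, solves_symmDiff_of_even hTsol hUeven, ?_⟩
    · -- properness: the only new ones are pigeon `i`'s variables at holes EMPTY in `T`
      rw [isFProper_holeClauses_iff]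
      have hTprop' := isFProper_holeClauses_iff.1 hTprop
      intro j i₁ i₂ hj hi₁₂ hi₂ ⟨h1, h2⟩
      simp only [assignOf_apply, decide_eq_true_eq, Finset.mem_symmDiff] at h1 h2
      -- a variable of `T ∆ U` outside `T` lies in `J`
      have hnew : ∀ {i' : ℕ}, i' * n + j ∈ U → i' * n + j ∉ T → i' = i ∧ j ∉ H := by
        intro i' hU hT
        rcases Finset.mem_union.1 (hUI hU) with h | h
        · exact absurd h hT
        · obtain ⟨j', hj', hj'H, heq⟩ := (hmemJ _).1 h
          have hjj : j = j' := by
            have := congrArg (· % n) heq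
            simpa only [pigeonVar_mod hj, pigeonVar_mod hj'] using this
          have hii : i' = i := by
            have := congrArg (· / n) heq
            simpa only [pigeonVar_div hj, pigeonVar_div hj'] using this
          subst hjj
          exact ⟨hii, hj'H⟩
      rcases h1 with ⟨h1T, -⟩ | ⟨h1U, h1T⟩ <;> rcases h2 with ⟨h2T, -⟩ | ⟨h2U, h2T⟩
      · exact hTprop' j i₁ i₂ hj hi₁₂ hi₂ ⟨by simpa using h1T, by simpa using h2T⟩
      · obtain ⟨-, hjH⟩ := hnew h2U h2T
        exact hempty j hj hjH i₁ h1T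
      · obtain ⟨-, hjH⟩ := hnew h1U h1T
        exact hempty j hj hjH i₂ h2T
      · obtain ⟨hi₁, -⟩ := hnew h1U h1T
        obtain ⟨hi₂', -⟩ := hnew h2U h2T
        omega
    · -- pigeon `i` sits in the empty hole of `v₀ ∈ U ∩ J`
      obtain ⟨j, hj, hjH, rfl⟩ := (hmemJ v₀).1 hv₀J
      have hnotT : i * n + j ∉ T := hplaced j hj
      simp only [Clause.eval, List.any_eq_true, List.mem_map, List.mem_range]
      refine ⟨(i * n + j, true), ⟨j, hj, rfl⟩, ?_⟩
      simp [Literal.eval, Finset.mem_symmDiff, hv₀U, hnotT]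

/-! ### Theorem 3: tree-like size and clause space of `PHPᵐₙ` -/

/-- **Theorem 3, tree-like size** [Gryaznov–Ovcharov–Riazanov 2024, Thm 3 (`2^{n-1}` in print);
Itsykson–Sokolov 2014, Thm 4 (`2^{(n-1)/2}`)]: for every number `m` of pigeons, every TREE-LIKE
Res(⊕) refutation (resolution rule + semantic weakening; every line used as a premise at most once)
of `PHPᵐₙ` has at least `2^n` lines. [cite: GryaznovOvcharovRiazanov2024, Theorem 3] -/
theorem two_pow_le_length_pigeonholeCNF_treeLike {m n : ℕ} {π : List ResLinLine}
    (hπ : IsResLinRefutation (pigeonholeCNF m n) π)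
    (htree : ∀ i : ℕ, (π.map fun l => l.premises.count i).sum ≤ 1) : 2 ^ n ≤ π.length :=
  two_pow_le_length_of_isExtensible (isExtensible_pigeonholeCNF m n)
    ⟨fun _ => false, isFProper_holeClauses_false m n⟩ hπ htree

/-- **Theorem 3, clause space** [Gryaznov–Ovcharov–Riazanov 2024, Thm 3 (`n - 1` in print)]: every
configuration-style Res(⊕) refutation of `PHPᵐₙ` keeps at least `n` linear clauses in memory at
some moment. [cite: GryaznovOvcharovRiazanov2024, Theorem 3] -/
theorem le_resLinClauseSpace_pigeonholeCNF {m n : ℕ} {π : List (Finset LinClause)}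
    (hπ : IsResLinSpaceRefutation (pigeonholeCNF m n) π) : n ≤ resLinClauseSpace π :=
  le_resLinClauseSpace_of_isExtensible (isExtensible_pigeonholeCNF m n)
    ⟨fun _ => false, isFProper_holeClauses_false m n⟩ hπ

/-- Theorem 3, clause space, `ℕ∞` form: the Res(⊕) clause space of `PHPᵐₙ` is at least `n`.
[Gryaznov–Ovcharov–Riazanov 2024, Thm 3] [cite: GryaznovOvcharovRiazanov2024, Theorem 3] -/
theorem le_minResLinClauseSpace_pigeonholeCNF (m n : ℕ) :
    (n : ℕ∞) ≤ minResLinClauseSpace (pigeonholeCNF m n) :=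
  le_minResLinClauseSpace_of_isExtensible (isExtensible_pigeonholeCNF m n)
    ⟨fun _ => false, isFProper_holeClauses_false m n⟩

/-! ### Non-vacuity: tree-like refutations of `PHPᵐₙ` exist -/

/-- Every variable of `PHPᵐₙ` is below `m·n`. [Haken 1985, §1] [cite: Haken1985, §1] -/
theorem fst_lt_of_mem_pigeonholeCNF {m n : ℕ} {c : Clause ℕ} (hc : c ∈ pigeonholeCNF m n)
    {l : Literal ℕ} (hl : l ∈ c) : l.1 < m * n := by
  have key : ∀ i j : ℕ, i < m → j < n → i * n + j < m * n := by
    intro i j hi hj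
    calc i * n + j < i * n + n := by omega
      _ = (i + 1) * n := by ring
      _ ≤ m * n := Nat.mul_le_mul_right n hi
  rcases mem_pigeonholeCNF_iff.1 hc with ⟨i, hi, rfl⟩ | ⟨j, i, i', hj, hii', hi', rfl⟩
  · simp only [List.mem_map, List.mem_range] at hl
    obtain ⟨j, hj, rfl⟩ := hl
    exact key i j hi hj
  · simp only [List.mem_cons, List.not_mem_nil, or_false] at hl
    rcases hl with rfl | rfl
    · exact key i j (by omega) hj
    · exact key i' j hi' hj

/-- **Theorem 3 is not vacuous**: for `m > n` the CNF `PHPᵐₙ` HAS tree-like Res(⊕) refutations —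
the decision tree on its `m·n` variables (`ResLinTreeLikeCompleteness.lean`), with exactly
`3·2^{mn} − 1` lines; so the minimum tree-like size lies between `2^n`
(`two_pow_le_length_pigeonholeCNF_treeLike`) and `3·2^{mn}`. (Print: `2^{Θ(n)}` for `m = n + 1`,
Oparin 2016 — not reproduced.) [Itsykson–Sokolov 2020, §2 (completeness); Haken 1985, §1]
[cite: ItsyksonSokolov2020, §2] -/
theorem exists_treeLike_isResLinRefutation_pigeonholeCNF {m n : ℕ} (h : n < m) :
    ∃ π : List ResLinLine, IsResLinRefutation (pigeonholeCNF m n) π ∧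
      (∀ i : ℕ, (π.map fun l => l.premises.count i).sum ≤ 1) ∧ π.length + 1 = 3 * 2 ^ (m * n) := by
  have hvars : ∀ c ∈ pigeonholeCNF m n, ∀ l ∈ c, l.1 ∈ List.range (m * n) :=
    fun c hc l hl => List.mem_range.2 (fst_lt_of_mem_pigeonholeCNF hc hl)
  obtain ⟨π, hπ, htree, hlen⟩ := exists_treeLike_isResLinRefutation
    (pigeonholeCNF_not_satisfiable_holds h) (List.nodup_range) hvars
  exact ⟨π, hπ, htree, by simpa using hlen⟩

/-- The two bounds side by side: for `m > n` there is a tree-like Res(⊕) refutation of `PHPᵐₙ`,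
and every one has at least `2^n` lines. [Gryaznov–Ovcharov–Riazanov 2024, Thm 3; folklore upper
bound] [cite: GryaznovOvcharovRiazanov2024, Theorem 3] -/
theorem treeLike_pigeonholeCNF_bounds {m n : ℕ} (h : n < m) :
    (∃ π : List ResLinLine, IsResLinRefutation (pigeonholeCNF m n) π ∧
      (∀ i : ℕ, (π.map fun l => l.premises.count i).sum ≤ 1) ∧ π.length < 3 * 2 ^ (m * n)) ∧
    (∀ π : List ResLinLine, IsResLinRefutation (pigeonholeCNF m n) π →
      (∀ i : ℕ, (π.map fun l => l.premises.count i).sum ≤ 1) → 2 ^ n ≤ π.length) := by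
  obtain ⟨π, hπ, htree, hlen⟩ := exists_treeLike_isResLinRefutation_pigeonholeCNF h
  exact ⟨⟨π, hπ, htree, by omega⟩, fun π hπ htree => two_pow_le_length_pigeonholeCNF_treeLike hπ htree⟩

end Literature.Computability.MetaComplexity
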